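import Literature.NumberTheory.LFunctions.WeilRescalingVariation
import Literature.NumberTheory.LFunctions.WeilGroundEnergyProofs
import HarnessLib

/-!
# The dilation virial IS the first variation of Weil's quadratic functional

Sibling of `Literature/NumberTheory/LFunctions/WeilDilationVirial.lean` (same normalisation), which
DEFINES the dilation virial `weilDilationVirial g = Re W(D(g ⋆ g̃))`, `D = t d/dt`, of a test
function `g` and announces the present file. Here we PROVE that this number is the derivative at
`η = 0` of `η ↦ Re Q(g_η)` along Bombieri's window-compressing unitary dilation
`g_η = weilDilate η g`, `g_η(t) = (1+η)^{1/2} g((1+η)t)` (E. Bombieri, Rend. Lincei (9) 11 (2000),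
§4, proof of Theorem 5: `f_ε(x) = (1+ε)^{1/2} x^{ε/2} f(x^{1+ε})`), together with the integrated
("fundamental theorem of calculus") form and its consequence for the window bottom
`ε = weilGroundEnergy`. The input is the rescaling calculus of
`WeilRescalingVariation.lean` (`d/dc W(k(c ·)) = W(t ↦ t k'(c t))`) and the identities
`Q(g_η) = W(k((1+η) ·))`, `k = g ⋆ g̃` (`weilQuadratic_weilDilate`) and `D(k(c ·)) = (Dk)(c ·)`.

## Main results (all proved; no named facts)

* `hasDerivAt_re_weilQuadratic_weilDilate` — **the virial theorem**:
  `HasDerivAt (fun η ↦ (weilQuadratic (weilDilate η g)).re) (weilDilationVirial g) 0`, and its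
  version at every `η₀ > -1` (`hasDerivAt_re_weilQuadratic_weilDilate_of_gt`, derivative
  `weilDilationVirial (weilDilate η₀ g) / (1 + η₀)`).
* `continuousOn_weilDilationVirial_weilDilate` — `η ↦ weilDilationVirial (weilDilate η g)` is
  continuous on `(-1, ∞)`.
* `re_weilQuadratic_weilDilate_eq_add_integral` — the integrated variation
  `Re Q(g_η) = Re Q(g) + ∫₀^η weilDilationVirial (g_s) / (1+s) ds` (`η > -1`).
* `weilGroundEnergy_div_le_add_integral_weilDilationVirial` — **Hadamard's variation inequality for
  the window bottom**: for a unit test function `g` in the window `[-a, a]` and `η > -1`,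
  `ε(a/(1+η)) ≤ Re Q(g) + ∫₀^η weilDilationVirial (g_s) / (1+s) ds`
  (the dilate `g_η` is an admissible unit competitor in the window `a/(1+η)`).

Bombieri (loc. cit.) uses only `T[f_ε * f_ε*] → T[f * f*]` (continuity of the bottom, Thm 5); the
derivative is the "Hadamard variation" input of route `RiemannHypothesis/WeilWindowFlow` and is
[folklore] calculus on the three explicit terms of `W`.

## References

* E. Bombieri, *Remarks on Weil's quadratic functional in the theory of prime numbers I*, Atti
  Accad. Naz. Lincei Rend. Lincei (9) Mat. Appl. 11 (2000), 183–233, §4, proof of Theorem 5.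
-/

noncomputable section

open Complex Filter Set MeasureTheory Metric
open scoped Real Topology ComplexConjugate ContDiff

namespace Literature.NumberTheory.LFunctions

variable {g k : ℝ → ℂ}

/-! ## The Euler generator under rescaling -/

/-- The Euler generator of a rescaling is the rescaled Euler generator:
`D(k(c ·)) = (Dk)(c ·)`. [folklore] -/
theorem weilDilationGenerator_comp_mul (hk : IsWeilTest k) (c : ℝ) :
    weilDilationGenerator (fun t ↦ k (c * t)) = fun t ↦ weilDilationGenerator k (c * t) := by
  funext t
  simp only [weilDilationGenerator_apply, deriv_comp_mul_of_isWeilTest hk c, Complex.ofReal_mul]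
  ring

/-- `t k'(c₀ t) = c₀⁻¹ (Dk)(c₀ t)` (`c₀ ≠ 0`). [folklore] -/
theorem ofReal_mul_deriv_comp_mul_eq (k : ℝ → ℂ) {c₀ : ℝ} (hc₀ : c₀ ≠ 0) :
    (fun t : ℝ ↦ (t : ℂ) * deriv k (c₀ * t)) =
      fun t ↦ (c₀ : ℂ)⁻¹ * weilDilationGenerator k (c₀ * t) := by
  funext t
  have hc : (c₀ : ℂ) ≠ 0 := Complex.ofReal_ne_zero.2 hc₀
  simp only [weilDilationGenerator_apply, Complex.ofReal_mul]
  field_simp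

/-! ## The Weil functional of a rescaling, derivative in generator form -/

/-- The same derivative written with the Euler generator: `d/dc|_{c₀} W(k(c ·)) = c₀⁻¹ W((Dk)(c₀ ·))`.
[folklore] -/
theorem hasDerivAt_weilFunctional_comp_mul' (hk : IsWeilTest k) {c₀ : ℝ} (hc₀ : 0 < c₀) :
    HasDerivAt (fun c : ℝ ↦ weilFunctional (fun t ↦ k (c * t)))
      ((c₀ : ℂ)⁻¹ * weilFunctional (fun t ↦ weilDilationGenerator k (c₀ * t))) c₀ := by
  have h := hasDerivAt_weilFunctional_comp_mul hk hc₀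
  rwa [ofReal_mul_deriv_comp_mul_eq k hc₀.ne', weilFunctional_const_mul] at h

/-- At `c₀ = 1`: `d/dc|₁ W(k(c ·)) = W(Dk)`, `Dk = weilDilationGenerator k`. [folklore] -/
theorem hasDerivAt_weilFunctional_comp_mul_one (hk : IsWeilTest k) :
    HasDerivAt (fun c : ℝ ↦ weilFunctional (fun t ↦ k (c * t)))
      (weilFunctional (weilDilationGenerator k)) 1 := by
  have h := hasDerivAt_weilFunctional_comp_mul hk one_pos
  have e : (fun t : ℝ ↦ (t : ℂ) * deriv k (1 * t)) = weilDilationGenerator k := by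
    funext t
    rw [one_mul, weilDilationGenerator_apply]
  rwa [e] at h
/-! ## The virial theorem: `d/dη Re Q(g_η)` along Bombieri's dilation -/

/-- **First variation of `Q` along Bombieri's dilation, at every `η₀ > -1`** (complex form):
`d/dη|_{η₀} Q(g_η) = (1+η₀)⁻¹ W(D(g_{η₀} ⋆ g̃_{η₀}))`. Indeed `Q(g_η) = W(k((1+η) ·))`,
`k = g ⋆ g̃` (`weilQuadratic_weilDilate`), and `D(k(c ·)) = (Dk)(c ·)`. [folklore] -/
theorem hasDerivAt_weilQuadratic_weilDilate_of_gt (hg : IsWeilTest g) {η₀ : ℝ} (hη₀ : -1 < η₀) :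
    HasDerivAt (fun η : ℝ ↦ weilQuadratic (weilDilate η g))
      (((1 + η₀ : ℝ) : ℂ)⁻¹ * weilFunctional (weilDilationGenerator
        (weilConv (weilDilate η₀ g) (weilReflect (weilDilate η₀ g))))) η₀ := by
  set k : ℝ → ℂ := weilConv g (weilReflect g) with hk_def
  have hk : IsWeilTest k := hg.weilConv hg.weilReflect
  have hc₀ : 0 < 1 + η₀ := by linarith
  have heq : (fun η : ℝ ↦ weilQuadratic (weilDilate η g)) =ᶠ[𝓝 η₀]
      fun η ↦ weilFunctional (fun t ↦ k ((1 + η) * t)) := by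
    filter_upwards [Ioi_mem_nhds hη₀] with η hη
    exact weilQuadratic_weilDilate g hη
  have hinner : HasDerivAt (fun η : ℝ ↦ 1 + η) 1 η₀ := by
    simpa using (hasDerivAt_id η₀).const_add 1
  have hcore : HasDerivAt (fun c : ℝ ↦ weilFunctional (fun t ↦ k (c * t)))
      (((1 + η₀ : ℝ) : ℂ)⁻¹ * weilFunctional (fun t ↦ weilDilationGenerator k ((1 + η₀) * t)))
      (1 + η₀) := hasDerivAt_weilFunctional_comp_mul' hk hc₀
  have hcomp := hcore.scomp η₀ hinner
  rw [one_smul] at hcomp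
  have h := hcomp.congr_of_eventuallyEq heq
  rwa [weilConv_weilDilate_weilReflect g hη₀, weilDilationGenerator_comp_mul hk]

/-- **The virial theorem at every `η₀ > -1`**: `η ↦ Re Q(g_η)` is differentiable at `η₀` with
derivative `weilDilationVirial (g_{η₀}) / (1 + η₀)`. [folklore] -/
theorem hasDerivAt_re_weilQuadratic_weilDilate_of_gt (hg : IsWeilTest g) {η₀ : ℝ} (hη₀ : -1 < η₀) :
    HasDerivAt (fun η : ℝ ↦ (weilQuadratic (weilDilate η g)).re)
      (weilDilationVirial (weilDilate η₀ g) / (1 + η₀)) η₀ := by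
  have h := hasDerivAt_weilQuadratic_weilDilate_of_gt hg hη₀
  have hre := Complex.reCLM.hasFDerivAt.comp_hasDerivAt η₀ h
  have e : Complex.reCLM (((1 + η₀ : ℝ) : ℂ)⁻¹ * weilFunctional (weilDilationGenerator
      (weilConv (weilDilate η₀ g) (weilReflect (weilDilate η₀ g))))) =
      weilDilationVirial (weilDilate η₀ g) / (1 + η₀) := by
    rw [Complex.reCLM_apply, ← Complex.ofReal_inv, Complex.re_ofReal_mul, weilDilationVirial_def]
    ring
  rw [e] at hre
  exact hre

/-- **The dilation virial IS the first variation of `Q` along Bombieri's dilation**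
(the theorem announced in `WeilDilationVirial.lean`): for every test function `g`,
`HasDerivAt (fun η ↦ Re Q(weilDilate η g)) (weilDilationVirial g) 0`.
[cite: Bombieri2000Weil, §4 proof of Thm 5 (the dilation; the derivative itself is folklore)] -/
theorem hasDerivAt_re_weilQuadratic_weilDilate (hg : IsWeilTest g) :
    HasDerivAt (fun η : ℝ ↦ (weilQuadratic (weilDilate η g)).re) (weilDilationVirial g) 0 := by
  have h := hasDerivAt_re_weilQuadratic_weilDilate_of_gt hg (by norm_num : (-1 : ℝ) < 0)
  simpa using h

/-- `deriv` form of the virial theorem. [folklore] -/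
theorem deriv_re_weilQuadratic_weilDilate (hg : IsWeilTest g) :
    deriv (fun η : ℝ ↦ (weilQuadratic (weilDilate η g)).re) 0 = weilDilationVirial g :=
  (hasDerivAt_re_weilQuadratic_weilDilate hg).deriv

/-! ## Continuity of the virial along the dilation orbit and the integrated variation -/

/-- Along the orbit the virial is a rescaled functional: for `η > -1`,
`weilDilationVirial (g_η) = Re W((Dk)((1+η) ·))`, `k = g ⋆ g̃`. [folklore] -/
theorem weilDilationVirial_weilDilate (hg : IsWeilTest g) {η : ℝ} (hη : -1 < η) :
    weilDilationVirial (weilDilate η g) = (weilFunctional fun t ↦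
      weilDilationGenerator (weilConv g (weilReflect g)) ((1 + η) * t)).re := by
  rw [weilDilationVirial_def, weilConv_weilDilate_weilReflect g hη,
    weilDilationGenerator_comp_mul (hg.weilConv hg.weilReflect)]

/-- **The virial is continuous along the dilation orbit**: `η ↦ weilDilationVirial (g_η)` is
continuous on `(-1, ∞)` (it is even differentiable: apply the first-variation theorem to the test
function `D(g ⋆ g̃)`). [folklore] -/
theorem continuousOn_weilDilationVirial_weilDilate (hg : IsWeilTest g) :
    ContinuousOn (fun η : ℝ ↦ weilDilationVirial (weilDilate η g)) (Ioi (-1)) := by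
  set k : ℝ → ℂ := weilConv g (weilReflect g) with hk_def
  have hk : IsWeilTest k := hg.weilConv hg.weilReflect
  have hD : IsWeilTest (weilDilationGenerator k) := hk.weilDilationGenerator
  intro η hη
  have hη' : -1 < η := hη
  refine ContinuousAt.continuousWithinAt ?_
  have h2 : ContinuousAt (fun c : ℝ ↦ weilFunctional (fun t ↦ weilDilationGenerator k (c * t)))
      (1 + η) := (hasDerivAt_weilFunctional_comp_mul hD (by linarith)).continuousAt
  have h3 : ContinuousAt (fun η : ℝ ↦ 1 + η) η := by fun_prop
  have h4 : ContinuousAt (fun η : ℝ ↦ (weilFunctional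
      (fun t ↦ weilDilationGenerator k ((1 + η) * t))).re) η :=
    Complex.continuous_re.continuousAt.comp (ContinuousAt.comp (x := η) h2 h3)
  have hev : (fun η : ℝ ↦ weilDilationVirial (weilDilate η g)) =ᶠ[𝓝 η]
      fun η ↦ (weilFunctional (fun t ↦ weilDilationGenerator k ((1 + η) * t))).re := by
    filter_upwards [Ioi_mem_nhds hη'] with η' hη''
    exact weilDilationVirial_weilDilate hg hη''
  exact h4.congr_of_eventuallyEq hev

/-- **Integrated first variation** (fundamental theorem of calculus along the orbit): for a test
function `g` and `η > -1`,
`Re Q(g_η) = Re Q(g) + ∫₀^η weilDilationVirial (g_s) / (1 + s) ds`. [folklore] -/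
theorem re_weilQuadratic_weilDilate_eq_add_integral (hg : IsWeilTest g) {η : ℝ} (hη : -1 < η) :
    (weilQuadratic (weilDilate η g)).re = (weilQuadratic g).re +
      ∫ s in (0 : ℝ)..η, weilDilationVirial (weilDilate s g) / (1 + s) := by
  have hsub : uIcc 0 η ⊆ Ioi (-1) := by
    intro s hs
    rcases le_total 0 η with h | h
    · rw [uIcc_of_le h] at hs
      exact lt_of_lt_of_le (by norm_num) hs.1
    · rw [uIcc_of_ge h] at hs
      exact lt_of_lt_of_le hη hs.1
  have hderiv : ∀ s ∈ uIcc 0 η, HasDerivAt (fun η : ℝ ↦ (weilQuadratic (weilDilate η g)).re)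
      (weilDilationVirial (weilDilate s g) / (1 + s)) s := fun s hs ↦
    hasDerivAt_re_weilQuadratic_weilDilate_of_gt hg (hsub hs)
  have hcont : ContinuousOn (fun s : ℝ ↦ weilDilationVirial (weilDilate s g) / (1 + s)) (uIcc 0 η) := by
    refine ContinuousOn.div ((continuousOn_weilDilationVirial_weilDilate hg).mono hsub)
      (by fun_prop) fun s hs ↦ ?_
    have := hsub hs
    simp only [mem_Ioi] at this
    linarith
  have hftc := intervalIntegral.integral_eq_sub_of_hasDerivAt hderiv hcont.intervalIntegrable
  simp only [weilDilate_zero] at hftc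
  linarith

/-! ## Hadamard's variation inequality for the window bottom -/

/-- **Hadamard's variation inequality for the window bottom `ε = weilGroundEnergy`.** For a test
function `g` with `tsupport g ⊆ [-a, a]`, `∫ |g|² = 1`, and every `η > -1`:
`ε(a/(1+η)) ≤ Re Q(g) + ∫₀^η weilDilationVirial (g_s)/(1+s) ds`
— the dilate `g_η` is a unit competitor in the window `[-a/(1+η), a/(1+η)]` (Bombieri 2000, proof
of Thm 5), and its form value is `Re Q(g)` plus the integrated virial along the orbit. Compressing
(`η > 0`) this bounds the RISE of the bottom to the left of `a`, expanding (`-1 < η < 0`) its DROP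
to the right, by the dilation virial of any unit test function of the window.
[cite: Bombieri2000Weil, §4 proof of Thm 5 (competitor); inequality with the virial: folklore] -/
theorem weilGroundEnergy_div_le_add_integral_weilDilationVirial (hg : IsWeilTest g) {a : ℝ}
    (hsupp : tsupport g ⊆ Icc (-a) a) (hnorm : ∫ t : ℝ, ‖g t‖ ^ 2 = 1) {η : ℝ} (hη : -1 < η) :
    weilGroundEnergy (a / (1 + η)) ≤ (weilQuadratic g).re +
      ∫ s in (0 : ℝ)..η, weilDilationVirial (weilDilate s g) / (1 + s) := by
  rw [← re_weilQuadratic_weilDilate_eq_add_integral hg hη]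
  refine csInf_le (bddBelow_weilQuadratic_sphere_holds _) ?_
  exact ⟨weilDilate η g, hg.weilDilate hη, tsupport_weilDilate_subset g hη hsupp,
    by rw [integral_norm_sq_weilDilate g hη, hnorm], rfl⟩

/-- The same inequality at first order (no integral): the one-sided difference quotients of
`η ↦ ε(a/(1+η))` at `η = 0` against a unit test function `g` of the window with `Re Q(g) = E`:
`ε(a/(1+η)) ≤ Re Q(g_η)` for all `η > -1`, where `η ↦ Re Q(g_η)` has value `E` and derivative
`weilDilationVirial g` at `0`. [cite: Bombieri2000Weil, §4 proof of Thm 5] -/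
theorem weilGroundEnergy_div_le_re_weilQuadratic_weilDilate (hg : IsWeilTest g) {a : ℝ}
    (hsupp : tsupport g ⊆ Icc (-a) a) (hnorm : ∫ t : ℝ, ‖g t‖ ^ 2 = 1) {η : ℝ} (hη : -1 < η) :
    weilGroundEnergy (a / (1 + η)) ≤ (weilQuadratic (weilDilate η g)).re := by
  refine csInf_le (bddBelow_weilQuadratic_sphere_holds _) ?_
  exact ⟨weilDilate η g, hg.weilDilate hη, tsupport_weilDilate_subset g hη hsupp,
    by rw [integral_norm_sq_weilDilate g hη, hnorm], rfl⟩

end Literature.NumberTheory.LFunctions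

end
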